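import Summits.Ventures.AbcSig.Rows.TemplateKraus
import Summits.Ventures.AbcSig.Levels.N98K11
import Summits.Ventures.AbcSig.Levels.N1568K11

/-!
# Venture AbcSig — ROW `X11Y11eq7Z2`: `x^11 + y^11 = 7 z²` (single exponent, Kraus-refined sieve; GENERATED by plean/leanrow.py)

HONEST FRAMING. A row of a COMPUTATION cell (`pub-abcsig`); a CONDITIONAL theorem, no claim on ABC or any summit.
Hypotheses: `BS04Package` (CITED), `DataComplete` at levels 98 and 1568 (COMPUTED, engine level files cross-checked),
`RefinedTraces` for the two Kraus-refined trace tables `krausAllowed_C7_v_n11` / `krausAllowed_C7_i_n11` (CITED+COMPUTED: exponent-11 images of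
the Frey traces, engine-2 allowed tables, referee refallowed.py), and the listed per-orbit exclusions `hX_…` (CITED;
R5 of the cell's row names each). Everything else is kernel-checked (`Rows/TemplateKraus.lean`, `Levels/N…K11.lean`).

-/

namespace Summit.Ventures.AbcSig

/-- Row `X11Y11eq7Z2`: `x^11 + y^11 = 7 z²` has no solution in nonzero pairwise coprime integers, conditional on the
named hypotheses (see module docstring). -/
theorem row_X11Y11eq7Z2 (M : NewformModel) (hP : M.BS04Package)
    (hD98 : M.DataComplete 98 level98k11Orbits) (hD1568 : M.DataComplete 1568 level1568k11Orbits)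
    (hAv : M.RefinedTraces (fun S => S.A = 1 ∧ S.B = 1 ∧ S.C = 7 ∧ S.n = 11 ∧ 2 ∣ S.a * S.b) krausAllowed_C7_v_n11)
    (hAi : M.RefinedTraces (fun S => S.A = 1 ∧ S.B = 1 ∧ S.C = 7 ∧ S.n = 11 ∧ ¬ 2 ∣ S.a * S.b) krausAllowed_C7_i_n11)
    (hX_orbit_1568_4_k11 : M.Excludes 1568 orbit_1568_4_k11 (fun S => S.A = 1 ∧ S.B = 1 ∧ S.C = 7 ∧ S.n = 11 ∧ ¬ 2 ∣ S.a * S.b))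
    (hX_orbit_1568_5_k11 : M.Excludes 1568 orbit_1568_5_k11 (fun S => S.A = 1 ∧ S.B = 1 ∧ S.C = 7 ∧ S.n = 11 ∧ ¬ 2 ∣ S.a * S.b))
    (hX_orbit_1568_6_k11 : M.Excludes 1568 orbit_1568_6_k11 (fun S => S.A = 1 ∧ S.B = 1 ∧ S.C = 7 ∧ S.n = 11 ∧ ¬ 2 ∣ S.a * S.b))
    (a b c : ℤ) : ¬ IsPrimitiveSolution 1 1 7 11 a b c := by
  have hC : Nat.Prime 7 := by norm_num
  have hn : Nat.Prime 11 := by norm_num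
  have hsf : Squarefree (7 : ℕ) := (Nat.prime_iff.mp hC).squarefree
  have hnC : ¬ 11 ∣ 7 := by decide
  by_cases hpar : 2 ∣ a * b
  · exact row_template_refined_even 7 hsf (by decide) M hP hD98 11 hn (by norm_num) hnC krausAllowed_C7_v_n11 hAv
      (level98k11_sieve 11 hn (by norm_num) (fun o => M.Excludes 98 o
        (fun S => S.A = 1 ∧ S.B = 1 ∧ S.C = 7 ∧ S.n = 11 ∧ 2 ∣ S.a * S.b)))
      a b c hpar
  · exact row_template_refined_odd 7 (by norm_num) hsf (by decide) M hP hD1568 11 hn (by norm_num) hnC krausAllowed_C7_i_n11 hAi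
      (level1568k11_sieve 11 hn (by norm_num) (fun o => M.Excludes 1568 o
        (fun S => S.A = 1 ∧ S.B = 1 ∧ S.C = 7 ∧ S.n = 11 ∧ ¬ 2 ∣ S.a * S.b)) (fun h => absurd h (by decide)) hX_orbit_1568_4_k11 hX_orbit_1568_5_k11 hX_orbit_1568_6_k11 (fun h => absurd h (by decide)))
      a b c hpar

end Summit.Ventures.AbcSig
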